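import Literature.Combinatorics.StablePolynomials.ElementarySymmetric
import HarnessLib

/-!
# The hypergeometric generating polynomial has only real zeros

For natural numbers `b, d, r` the polynomial
`H_{b,d,r}(z) = Σ_k C(b,k) C(d,r−k) z^k`
— `C(b+d,r)` times the probability generating function of the hypergeometric law (number of marked
items in a uniform `r`-subset of `b` marked and `d` unmarked items) — has only real zeros. Hence a
hypergeometric random variable is distributed as a sum of independent Bernoulli variables, the
fact behind the local limit theory of sampling without replacement (Vatutin–Mikhailov, *Limit
theorems for the number of empty cells in an equiprobable scheme for group allocation of particles*,
Theory Probab. Appl. 27 (1983) 734–743 — the hypergeometric case of Harper's method; Pitman, *Probabilistic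
bounds on the coefficients of polynomials with only real zeros*, JCTA 77 (1997) 279–303, §1).

Proof here (Borcea–Brändén–Liggett, *Negative dependence and the geometry of polynomials*, JAMS 22
(2009), §3: the elementary symmetric polynomials are stable and stability survives real
specialisation and identification of variables): `H_{b,d,r}(z)` is the value of `e_r` on `b + d`
variables at the point with `b` coordinates equal to `z` and `d` coordinates equal to `1`
(`eval_esymm_twoBlock`); if `H(z₀) = 0` with `Im z₀ ≠ 0`, pick `λ` with `Im λ > 0` and
`Im (λ z₀) > 0`; by homogeneity `e_r(λ z₀,…,λ z₀,λ,…,λ) = λ^r H(z₀) = 0`, contradicting the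
stability of `e_r` (tree: `isUpperHalfPlaneStable_esymm`, via Gauss–Lucas). All PROVED, 0 sorry,
no named facts. (Cell pnp-psdrank, LIT-44 §3(b): the independence structure used for the
`x`-smoothness of shell laws.)

## References

* [VatutinMikhailov1983] V. A. Vatutin, V. G. Mikhailov, Theory Probab. Appl. 27:4 (1983)
  734–743, §2 (the generating function of the hypergeometric-type law has real roots).
* [Pitman1997] J. Pitman, JCTA 77 (1997) 279–303, §1 (real zeros ⇔ sum of independent
  Bernoulli variables; examples).
* [BorceaBrandenLiggett2007] J. Borcea, P. Brändén, T. M. Liggett, JAMS 22 (2009) 521–567, §3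
  (stability of `e_r`; closure under specialisation and diagonalisation).
* [BorceaBranden2009] J. Borcea, P. Brändén, Invent. Math. 177 (2009), Prop. 2.4 (`e_r` stable).
-/

noncomputable section

open Finset MvPolynomial

namespace Literature.Combinatorics.StablePolynomials

/-! ### §1 The two-block evaluation of `e_r` -/

section TwoBlock

variable {b d : ℕ}

/-- The left part of a finset of `Fin b ⊕ Fin d`. [cite: BorceaBrandenLiggett2007, §3] -/
def toL (t : Finset (Fin b ⊕ Fin d)) : Finset (Fin b) := univ.filter fun a => Sum.inl a ∈ t

/-- The right part of a finset of `Fin b ⊕ Fin d`. [cite: BorceaBrandenLiggett2007, §3] -/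
def toR (t : Finset (Fin b ⊕ Fin d)) : Finset (Fin d) := univ.filter fun c => Sum.inr c ∈ t

/-- Membership in the left part. [cite: BorceaBrandenLiggett2007, §3] -/
@[simp] theorem mem_toL {t : Finset (Fin b ⊕ Fin d)} {a : Fin b} : a ∈ toL t ↔ Sum.inl a ∈ t := by
  simp [toL]

/-- Membership in the right part. [cite: BorceaBrandenLiggett2007, §3] -/
@[simp] theorem mem_toR {t : Finset (Fin b ⊕ Fin d)} {c : Fin d} : c ∈ toR t ↔ Sum.inr c ∈ t := by
  simp [toR]

/-- A finset of the sum type is the disjoint sum of its parts. [cite: BorceaBrandenLiggett2007, §3] -/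
theorem disjSum_toL_toR (t : Finset (Fin b ⊕ Fin d)) : (toL t).disjSum (toR t) = t := by
  ext x
  rcases x with a | c
  · rw [inl_mem_disjSum, mem_toL]
  · rw [inr_mem_disjSum, mem_toR]

/-- The left part of a disjoint sum. [cite: BorceaBrandenLiggett2007, §3] -/
@[simp] theorem toL_disjSum (s : Finset (Fin b)) (u : Finset (Fin d)) : toL (s.disjSum u) = s := by
  ext a; rw [mem_toL, inl_mem_disjSum]

/-- The right part of a disjoint sum. [cite: BorceaBrandenLiggett2007, §3] -/
@[simp] theorem toR_disjSum (s : Finset (Fin b)) (u : Finset (Fin d)) : toR (s.disjSum u) = u := by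
  ext c; rw [mem_toR, inr_mem_disjSum]

/-- `|t| = |toL t| + |toR t|`. [cite: BorceaBrandenLiggett2007, §3] -/
theorem card_eq_toL_add_toR (t : Finset (Fin b ⊕ Fin d)) : t.card = (toL t).card + (toR t).card := by
  conv_lhs => rw [← disjSum_toL_toR t]
  exact card_disjSum _ _

/-- The two-block point: `z` on the first block, `w` on the second. [cite: BorceaBrandenLiggett2007, §3] -/
def twoBlock (b d : ℕ) (z w : ℂ) : Fin b ⊕ Fin d → ℂ := Sum.elim (fun _ => z) (fun _ => w)

/-- A monomial at the two-block point. [cite: BorceaBrandenLiggett2007, §3] -/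
theorem prod_twoBlock (z w : ℂ) (t : Finset (Fin b ⊕ Fin d)) :
    ∏ x ∈ t, twoBlock b d z w x = z ^ (toL t).card * w ^ (toR t).card := by
  conv_lhs => rw [← disjSum_toL_toR t]
  rw [prod_disjSum]
  simp [twoBlock]

/-- The number of `r`-subsets of `Fin b ⊕ Fin d` with `k` elements in the first block is
`C(b,k)·C(d,r−k)` (`k ≤ r`). [cite: Pitman1997, §1] -/
theorem card_powersetCard_filter_toL (r k : ℕ) (hk : k ≤ r) :
    ((powersetCard r (univ : Finset (Fin b ⊕ Fin d))).filter fun t => (toL t).card = k).card =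
      b.choose k * d.choose (r - k) := by
  rw [← card_fin b, ← card_fin d, ← card_powersetCard k (univ : Finset (Fin b)),
    ← card_powersetCard (r - k) (univ : Finset (Fin d)), ← card_product, card_fin, card_fin]
  symm
  refine card_nbij' (fun p => p.1.disjSum p.2) (fun t => (toL t, toR t)) ?_ ?_ ?_ ?_
  · rintro ⟨s, u⟩ hp
    simp only [mem_coe, mem_product, mem_powersetCard] at hp
    obtain ⟨⟨-, hs⟩, -, hu⟩ := hp
    simp only [mem_coe, mem_filter, mem_powersetCard, toL_disjSum]
    exact ⟨⟨subset_univ _, by rw [card_disjSum, hs, hu]; omega⟩, hs⟩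
  · intro t ht
    simp only [mem_coe, mem_filter, mem_powersetCard] at ht
    obtain ⟨⟨-, hr⟩, hkL⟩ := ht
    simp only [mem_coe, mem_product, mem_powersetCard]
    have := card_eq_toL_add_toR t
    exact ⟨⟨subset_univ _, hkL⟩, subset_univ _, by omega⟩
  · rintro ⟨s, u⟩ _
    simp
  · intro t _
    exact disjSum_toL_toR t

/-- **`e_r` at the two-block point is the hypergeometric generating polynomial**:
`e_r(z,…,z,w,…,w) = Σ_{k ≤ r} C(b,k)C(d,r−k) z^k w^{r−k}`. [cite: BorceaBrandenLiggett2007, §3] -/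
theorem eval_esymm_twoBlock (b d r : ℕ) (z w : ℂ) :
    MvPolynomial.eval (twoBlock b d z w) (MvPolynomial.esymm (Fin b ⊕ Fin d) ℂ r) =
      ∑ k ∈ range (r + 1), ((b.choose k * d.choose (r - k) : ℕ) : ℂ) * z ^ k * w ^ (r - k) := by
  simp only [MvPolynomial.esymm, map_sum, map_prod, MvPolynomial.eval_X]
  rw [sum_congr rfl fun t _ => prod_twoBlock z w t]
  -- group the `r`-subsets by the size of their left part
  rw [← sum_fiberwise_of_maps_to (s := powersetCard r (univ : Finset (Fin b ⊕ Fin d)))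
    (t := range (r + 1)) (g := fun t => (toL t).card) (fun t ht => by
      rw [mem_powersetCard] at ht
      rw [mem_range]
      have := card_eq_toL_add_toR t
      omega)]
  refine sum_congr rfl fun k hk => ?_
  have hkr : k ≤ r := Nat.lt_succ_iff.1 (mem_range.1 hk)
  have hterm : ∀ t ∈ (powersetCard r (univ : Finset (Fin b ⊕ Fin d))).filter (fun t => (toL t).card = k),
      z ^ (toL t).card * w ^ (toR t).card = z ^ k * w ^ (r - k) := by
    intro t ht
    rw [mem_filter, mem_powersetCard] at ht
    have := card_eq_toL_add_toR t
    rw [ht.2, show (toR t).card = r - k by omega]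
  rw [sum_congr rfl hterm, sum_const, card_powersetCard_filter_toL r k hkr, nsmul_eq_mul]
  ring

end TwoBlock

/-! ### §2 The hypergeometric generating polynomial and its zeros -/

/-- The (unnormalised) hypergeometric generating polynomial `H_{b,d,r} = Σ_k C(b,k)C(d,r−k) X^k`.
[cite: VatutinMikhailov1983, §2] -/
def hyperGen (b d r : ℕ) : Polynomial ℝ :=
  ∑ k ∈ range (r + 1), Polynomial.C ((b.choose k * d.choose (r - k) : ℕ) : ℝ) * Polynomial.X ^ k

/-- Its value at a complex point. [cite: VatutinMikhailov1983, §2] -/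
theorem aeval_hyperGen (b d r : ℕ) (z : ℂ) :
    Polynomial.aeval z (hyperGen b d r) =
      ∑ k ∈ range (r + 1), ((b.choose k * d.choose (r - k) : ℕ) : ℂ) * z ^ k := by
  simp [hyperGen, map_sum]

/-- Its value is `e_r` at the two-block point `(z,…,z,1,…,1)`. [cite: BorceaBrandenLiggett2007, §3] -/
theorem aeval_hyperGen_eq_eval_esymm (b d r : ℕ) (z : ℂ) :
    Polynomial.aeval z (hyperGen b d r) =
      MvPolynomial.eval (twoBlock b d z 1) (MvPolynomial.esymm (Fin b ⊕ Fin d) ℂ r) := by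
  rw [aeval_hyperGen, eval_esymm_twoBlock]
  simp

/-- A rotation putting a non-real number `z` and the number `1` simultaneously in the open upper
half-plane: `λ = (−Im z (|Re z|+1) + i (Im z)²)·conj z`. [cite: BorceaBrandenLiggett2007, §3] -/
theorem exists_rotation_of_im_ne_zero {z : ℂ} (hz : z.im ≠ 0) :
    ∃ lam : ℂ, 0 < lam.im ∧ 0 < (lam * z).im := by
  have hz0 : z ≠ 0 := fun h => hz (by rw [h]; simp)
  refine ⟨(⟨-(z.im * (|z.re| + 1)), z.im ^ 2⟩ : ℂ) * (starRingEnd ℂ) z, ?_, ?_⟩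
  · have h1 : ((⟨-(z.im * (|z.re| + 1)), z.im ^ 2⟩ : ℂ) * (starRingEnd ℂ) z).im =
        z.im ^ 2 * (z.re + |z.re| + 1) := by
      simp only [Complex.mul_im, Complex.conj_re, Complex.conj_im]; ring
    rw [h1]
    have h2 : 0 < z.im ^ 2 := by positivity
    have h3 : 0 < z.re + |z.re| + 1 := by have := neg_abs_le z.re; linarith
    exact mul_pos h2 h3
  · have h1 : ((⟨-(z.im * (|z.re| + 1)), z.im ^ 2⟩ : ℂ) * (starRingEnd ℂ) z * z).im =
        z.im ^ 2 * Complex.normSq z := by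
      rw [mul_assoc, mul_comm ((starRingEnd ℂ) z) z, Complex.mul_conj, Complex.mul_im,
        Complex.ofReal_re, Complex.ofReal_im, mul_zero, zero_add]
    rw [h1]
    exact mul_pos (by positivity) (Complex.normSq_pos.2 hz0)

/-- **The hypergeometric generating polynomial has only real zeros** (`r ≤ b + d`; for `r > b + d`
it is the zero polynomial): every complex zero of `Σ_k C(b,k)C(d,r−k) z^k` is real. Equivalently a
hypergeometric random variable is a sum of independent Bernoulli variables.
[cite: VatutinMikhailov1983, §2] [cite: Pitman1997, §1] [cite: BorceaBrandenLiggett2007, §3] -/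
theorem im_eq_zero_of_aeval_hyperGen_eq_zero {b d r : ℕ} (hr : r ≤ b + d) {z : ℂ}
    (hz : Polynomial.aeval z (hyperGen b d r) = 0) : z.im = 0 := by
  by_contra him
  obtain ⟨lam, hlam, hlamz⟩ := exists_rotation_of_im_ne_zero him
  have hstab := isUpperHalfPlaneStable_esymm (σ := Fin b ⊕ Fin d) (N := r)
    (by rw [Fintype.card_sum, Fintype.card_fin, Fintype.card_fin]; exact hr)
  refine hstab (twoBlock b d (lam * z) lam) ?_ ?_
  · rintro (a | c)
    · simpa [twoBlock] using hlamz
    · simpa [twoBlock] using hlam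
  · rw [eval_esymm_twoBlock]
    have key : ∀ k ∈ range (r + 1),
        ((b.choose k * d.choose (r - k) : ℕ) : ℂ) * (lam * z) ^ k * lam ^ (r - k) =
          lam ^ r * (((b.choose k * d.choose (r - k) : ℕ) : ℂ) * z ^ k) := by
      intro k hk
      have hkr : k ≤ r := Nat.lt_succ_iff.1 (mem_range.1 hk)
      rw [mul_pow, show lam ^ r = lam ^ k * lam ^ (r - k) by rw [← pow_add, Nat.add_sub_cancel' hkr]]
      ring
    rw [sum_congr rfl key, ← mul_sum, ← aeval_hyperGen, hz, mul_zero]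

/-- Root form: every root of `H_{b,d,r}` in `ℂ` is real. [cite: VatutinMikhailov1983, §2] -/
theorem mem_roots_hyperGen_im_eq_zero {b d r : ℕ} (hr : r ≤ b + d) {z : ℂ}
    (hz : z ∈ ((hyperGen b d r).map (algebraMap ℝ ℂ)).roots) : z.im = 0 := by
  have h := (Polynomial.mem_roots'.1 hz).2
  rw [Polynomial.IsRoot.def, Polynomial.eval_map, ← Polynomial.aeval_def] at h
  exact im_eq_zero_of_aeval_hyperGen_eq_zero hr h

end Literature.Combinatorics.StablePolynomials

end
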